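import Summits.ValiantsHypothesis.ValiantsHypothesis.Theses.PartialSorting
import Summits.ValiantsHypothesis.ValiantsHypothesis.Theorems.PartialSortingBruhatDetInVNPIndicator
import Summits.ValiantsHypothesis.ValiantsHypothesis.Theorems.DetQPDetqpThesisStubIsVNPFamilyHyperdet
import Literature.Computability.AlgebraicComplexity.BruhatDeterminants
import Literature.Computability.AlgebraicComplexity.DetInVP
import Literature.Computability.AlgebraicComplexity.ValiantClassesProofs

/-!
# Route `PartialSorting`, item `BruhatDetInVNP` (stmt-ValiantsHypothesis-13593):
# every Bruhat-truncated determinant family is in `VNP`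

For every advice sequence `w = (w_n : Fin n → Fin n)_n`, the family
`D_{w_n} = ∑_{σ ∈ 𝔖_n : σ[i,j] ≤ w_n[i,j] ∀ i j} sgn σ · ∏ₐ X_{a, σ a}` (`bruhatDet ℂ n (w n)`,
rank criterion of Björner–Brenti 2005, Thm. 2.1.5, `σ[i,j] = #{a ≤ i : j ≤ σ a}`) is p-definable
over `ℂ` (Bürgisser 2000, Def. 2.5 = `IsVNPFamily`): `bruhatDetInVNP_proof`.

The witness (BCS 1997, Prop. (21.15) technique, as in `HamiltonianCycleVNP.lean` and
`DetQPDetqpThesisStubIsVNPFamilyHyperdet.lean`; written out, no definitions): the Boolean block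
is one `n × n` position matrix `Z` (`Z_{a b} = X (inr (finProdFinEquiv (a, b)))`, "`σ a = b`"),
and

  `G_n = α(Z) β(Z) · (det Z · (R_w(Z) · ∏ₐ ∑_b Z_{a b} x_{a b}))`,

where `α β` is BCS's permutation-matrix recogniser (`sum_recogniser_mul`), `det Z` gives
`sgn σ` at `Z = P_σ` (`det_of_permGraph`), the last factor gives the monomial `∏ₐ x_{a, σ a}`,
and the rank test `R_w(Z) = ∏_{i,j} ∑_{v ≤ w[i,j]} ℓ_v(∑_{a ≤ i, b ≥ j} Z_{a b})` (Lagrange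
indicators `ℓ_v` on the nodes `0, …, n`, characteristic `0`; `algHom_thresh`,
`algHom_rankCount`) gives `[σ[i,j] ≤ w[i,j] ∀ i j]`. Summing over `{0,1}^{n²}` leaves
`∑_σ [σ ≤ w] sgn σ x^σ = D_w` (`boolSum_witness`). Size: `2n²` variables, degree `≤ 7 (n+1)⁴`,
complexity `≤ 40 (n+1)⁷`; `D_w` itself has `n²` variables and degree `≤ n`.

References: L. G. Valiant, *Completeness classes in algebra*, STOC 1979; P. Bürgisser,
M. Clausen, M. A. Shokrollahi, *Algebraic Complexity Theory* (1997), Prop. (21.15);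
P. Bürgisser, *Completeness and Reduction in Algebraic Complexity Theory* (2000), Def. 2.3–2.5,
Prop. 2.20; A. Björner, F. Brenti, *Combinatorics of Coxeter Groups* (2005), Thm. 2.1.5.
-/

noncomputable section

-- single-conjunct layout: Sub = Summit, duplicated namespace component intended
set_option linter.dupNamespace false

namespace Summit.ValiantsHypothesis.ValiantsHypothesis.Theorems

namespace BruhatDetVNP

open Literature.Computability.AlgebraicComplexity MvPolynomial Finset Equiv
open DetQPDetqpThesis.HyperdetVNP

universe u

/-! ### Boolean sums over one position matrix -/

section BoolSum

variable (n : ℕ) (k : Type u) [Field k]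

/-- `boolSum` over the Boolean block `Fin (n·n) ≃ Fin n × Fin n` as a sum over Boolean `n × n`
matrices `E`, position variable `q` being set to `[E (finProdFinEquiv⁻¹ q)]`. [folklore] -/
theorem boolSum_eq_sum_matrix (g : MvPolynomial ((Fin n × Fin n) ⊕ Fin (n * n)) k) :
    boolSum g = ∑ E : Fin n × Fin n → Bool,
      aeval (Sum.elim X fun q => if E (finProdFinEquiv.symm q) then
        (1 : MvPolynomial (Fin n × Fin n) k) else 0) g := by
  unfold boolSum
  exact Fintype.sum_equiv (Equiv.arrowCongr finProdFinEquiv.symm (Equiv.refl Bool)) _ _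
    fun x => by
      simp only [Equiv.arrowCongr_apply, Function.comp_apply, Equiv.coe_refl, id_eq,
        Equiv.symm_symm, Equiv.apply_symm_apply]

/-- Evaluation of a position variable at the Boolean matrix `E`. [folklore] -/
theorem aevalAt_Z (E : Fin n × Fin n → Bool) (p : Fin n × Fin n) :
    aeval (Sum.elim X fun q => if E (finProdFinEquiv.symm q) then
        (1 : MvPolynomial (Fin n × Fin n) k) else 0)
      (X (Sum.inr (finProdFinEquiv p)) : MvPolynomial ((Fin n × Fin n) ⊕ Fin (n * n)) k) =
      if E p then 1 else 0 := by
  simp only [aeval_X, Sum.elim_inr, Equiv.symm_apply_apply]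

/-- Evaluation of a matrix variable at the Boolean matrix `E` (it is untouched). [folklore] -/
theorem aevalAt_X_inl (E : Fin n × Fin n → Bool) (p : Fin n × Fin n) :
    aeval (Sum.elim X fun q => if E (finProdFinEquiv.symm q) then
        (1 : MvPolynomial (Fin n × Fin n) k) else 0)
      (X (Sum.inl p) : MvPolynomial ((Fin n × Fin n) ⊕ Fin (n * n)) k) = X p := by
  simp

/-- At the position matrix `P_σ` the determinant of `Z` is `sgn σ`. [folklore] -/
theorem aevalAt_detZ (σ : Perm (Fin n)) :
    aeval (Sum.elim X fun q => if permGraph σ (finProdFinEquiv.symm q) then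
        (1 : MvPolynomial (Fin n × Fin n) k) else 0)
      (rename (fun p => Sum.inr (finProdFinEquiv p)) (detPoly (Fin n) k) :
        MvPolynomial ((Fin n × Fin n) ⊕ Fin (n * n)) k) =
      (Equiv.Perm.sign σ : MvPolynomial (Fin n × Fin n) k) := by
  rw [aeval_rename_detPoly]
  simp only [Sum.elim_inr, Equiv.symm_apply_apply]
  exact det_of_permGraph σ

/-- At the position matrix `P_σ` the cover product is the monomial `∏ₐ x_{a, σ a}`. [folklore] -/
theorem aevalAt_cover (σ : Perm (Fin n)) :
    aeval (Sum.elim X fun q => if permGraph σ (finProdFinEquiv.symm q) then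
        (1 : MvPolynomial (Fin n × Fin n) k) else 0)
      (∏ a : Fin n, ∑ b : Fin n, X (Sum.inr (finProdFinEquiv (a, b))) * X (Sum.inl (a, b)) :
        MvPolynomial ((Fin n × Fin n) ⊕ Fin (n * n)) k) = ∏ a : Fin n, X (a, σ a) := by
  simp only [map_prod, map_sum, map_mul, aevalAt_Z, aevalAt_X_inl]
  refine prod_congr rfl fun a _ => ?_
  rw [sum_eq_single (σ a)]
  · simp [permGraph]
  · intro b _ hb
    simp [permGraph, Ne.symm hb]
  · simp

variable [CharZero k]

/-- **The rank test at `P_σ`**: the product of the threshold gadgets over all `(i, j)` takes the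
value `[σ[i,j] ≤ w[i,j] ∀ i j]` (Björner–Brenti 2005, Thm. 2.1.5: the rank criterion for
`σ ≤ w`). [folklore] -/
theorem aevalAt_rankTest (w : Fin n → Fin n) (σ : Perm (Fin n)) :
    aeval (Sum.elim X fun q => if permGraph σ (finProdFinEquiv.symm q) then
        (1 : MvPolynomial (Fin n × Fin n) k) else 0)
      (∏ i : Fin n, ∏ j : Fin n,
        ∑ v ∈ range ((univ.filter fun a : Fin n => a ≤ i ∧ j ≤ w a).card + 1),
          C (∏ u ∈ (range (n + 1)).erase v, ((v : k) - u))⁻¹ *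
            ∏ u ∈ (range (n + 1)).erase v,
              ((∑ a ∈ univ.filter (fun a : Fin n => a ≤ i),
                  ∑ b ∈ univ.filter (fun b : Fin n => j ≤ b),
                    X (Sum.inr (finProdFinEquiv (a, b)))) + C (-(u : k))) :
        MvPolynomial ((Fin n × Fin n) ⊕ Fin (n * n)) k) =
      if (∀ i j : Fin n, (univ.filter (fun a : Fin n => a ≤ i ∧ j ≤ σ a)).card ≤
          (univ.filter (fun a : Fin n => a ≤ i ∧ j ≤ w a)).card) then 1 else 0 := by
  have hZ : ∀ p : Fin n × Fin n,
      aeval (Sum.elim X fun q => if permGraph σ (finProdFinEquiv.symm q) then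
          (1 : MvPolynomial (Fin n × Fin n) k) else 0)
        (X (Sum.inr (finProdFinEquiv p)) : MvPolynomial ((Fin n × Fin n) ⊕ Fin (n * n)) k) =
        if σ p.1 = p.2 then 1 else 0 := fun p => by
    rw [aevalAt_Z]
    simp [permGraph]
  rw [map_prod]
  simp_rw [map_prod]
  have hT : ∀ i j : Fin n,
      aeval (Sum.elim X fun q => if permGraph σ (finProdFinEquiv.symm q) then
          (1 : MvPolynomial (Fin n × Fin n) k) else 0)
        (∑ v ∈ range ((univ.filter fun a : Fin n => a ≤ i ∧ j ≤ w a).card + 1),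
          C (∏ u ∈ (range (n + 1)).erase v, ((v : k) - u))⁻¹ *
            ∏ u ∈ (range (n + 1)).erase v,
              ((∑ a ∈ univ.filter (fun a : Fin n => a ≤ i),
                  ∑ b ∈ univ.filter (fun b : Fin n => j ≤ b),
                    X (Sum.inr (finProdFinEquiv (a, b)))) + C (-(u : k))) :
          MvPolynomial ((Fin n × Fin n) ⊕ Fin (n * n)) k) =
        if (univ.filter (fun a : Fin n => a ≤ i ∧ j ≤ σ a)).card ≤
            (univ.filter (fun a : Fin n => a ≤ i ∧ j ≤ w a)).card then 1 else 0 :=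
    fun i j => algHom_thresh _ _ _
      (algHom_rankCount _ (fun p => X (Sum.inr (finProdFinEquiv p))) σ hZ i j)
      (card_filter_univ_fin_le _)
  simp_rw [hT, Fintype.prod_boole]
  by_cases h : ∀ i j : Fin n, (univ.filter (fun a : Fin n => a ≤ i ∧ j ≤ σ a)).card ≤
      (univ.filter (fun a : Fin n => a ≤ i ∧ j ≤ w a)).card
  · rw [if_pos h]
    exact prod_eq_one fun i _ => if_pos (h i)
  · rw [if_neg h]
    obtain ⟨i, hi⟩ := not_forall.1 h
    exact prod_eq_zero (mem_univ i) (if_neg hi)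

/-- **`D_w` is the Boolean sum of the witness** over the position matrix
(BCS 1997, Prop. (21.15): (A)–(D) for the recogniser; then sign, rank test and cover at `P_σ`).
[folklore] -/
theorem boolSum_witness (w : Fin n → Fin n) :
    boolSum (((∏ pq ∈ conflictPairs n,
          (1 - X (Sum.inr (finProdFinEquiv pq.1)) * X (Sum.inr (finProdFinEquiv pq.2)))) *
        ∏ t : Fin n, ∑ i : Fin n, X (Sum.inr (finProdFinEquiv (t, i)))) *
      (rename (fun p => Sum.inr (finProdFinEquiv p)) (detPoly (Fin n) k) *
        ((∏ i : Fin n, ∏ j : Fin n,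
            ∑ v ∈ range ((univ.filter fun a : Fin n => a ≤ i ∧ j ≤ w a).card + 1),
              C (∏ u ∈ (range (n + 1)).erase v, ((v : k) - u))⁻¹ *
                ∏ u ∈ (range (n + 1)).erase v,
                  ((∑ a ∈ univ.filter (fun a : Fin n => a ≤ i),
                      ∑ b ∈ univ.filter (fun b : Fin n => j ≤ b),
                        X (Sum.inr (finProdFinEquiv (a, b)))) + C (-(u : k)))) *
          ∏ a : Fin n, ∑ b : Fin n, X (Sum.inr (finProdFinEquiv (a, b))) * X (Sum.inl (a, b)))) :
      MvPolynomial ((Fin n × Fin n) ⊕ Fin (n * n)) k) = bruhatDet k n w := by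
  rw [boolSum_eq_sum_matrix]
  simp only [map_mul]
  have h1 : ∀ E : Fin n × Fin n → Bool,
      aeval (Sum.elim X fun q => if E (finProdFinEquiv.symm q) then
          (1 : MvPolynomial (Fin n × Fin n) k) else 0)
        ((∏ pq ∈ conflictPairs n,
          (1 - X (Sum.inr (finProdFinEquiv pq.1)) * X (Sum.inr (finProdFinEquiv pq.2)))) :
          MvPolynomial ((Fin n × Fin n) ⊕ Fin (n * n)) k) =
        ∏ pq ∈ conflictPairs n, (1 - (if E pq.1 then (1 : MvPolynomial (Fin n × Fin n) k)
          else 0) * (if E pq.2 then (1 : MvPolynomial (Fin n × Fin n) k) else 0)) := fun E => by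
    simp only [map_prod, map_sub, map_one, map_mul, aevalAt_Z]
  have h2 : ∀ E : Fin n × Fin n → Bool,
      aeval (Sum.elim X fun q => if E (finProdFinEquiv.symm q) then
          (1 : MvPolynomial (Fin n × Fin n) k) else 0)
        (∏ t : Fin n, ∑ i : Fin n, X (Sum.inr (finProdFinEquiv (t, i))) :
          MvPolynomial ((Fin n × Fin n) ⊕ Fin (n * n)) k) =
        ∏ t, ∑ i, (if E (t, i) then (1 : MvPolynomial (Fin n × Fin n) k) else 0) := fun E => by
    simp only [map_prod, map_sum, aevalAt_Z]
  simp_rw [h1, h2]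
  rw [sum_recogniser_mul]
  unfold bruhatDet
  refine sum_congr rfl fun σ _ => ?_
  rw [aevalAt_detZ, aevalAt_rankTest, aevalAt_cover]
  split_ifs
  · rw [one_mul, Units.smul_def, zsmul_eq_mul]
  · rw [zero_mul, mul_zero]

end BoolSum

/-! ### Size of the witness -/

section Bounds

variable (n : ℕ) (k : Type u) [Field k]

/-- `deg α(Z) ≤ 2 n⁴`. [folklore] -/
theorem totalDegree_alpha_le :
    (∏ pq ∈ conflictPairs n,
        (1 - X (Sum.inr (finProdFinEquiv pq.1)) * X (Sum.inr (finProdFinEquiv pq.2))) :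
      MvPolynomial ((Fin n × Fin n) ⊕ Fin (n * n)) k).totalDegree ≤ n ^ 4 * 2 :=
  (totalDegree_prod_le_of_le _ _ _ fun _ _ => totalDegree_one_sub_X_mul_X_le _ _).trans
    (Nat.mul_le_mul_right 2 (card_conflictPairs_le _))

/-- `deg β(Z) ≤ n`. [folklore] -/
theorem totalDegree_beta_le :
    (∏ t : Fin n, ∑ i : Fin n, X (Sum.inr (finProdFinEquiv (t, i))) :
      MvPolynomial ((Fin n × Fin n) ⊕ Fin (n * n)) k).totalDegree ≤ n * 1 :=
  (totalDegree_prod_le_of_le _ _ _ fun _ _ =>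
    totalDegree_sum_le_of_le _ _ _ fun _ _ => totalDegree_X_le_one _).trans (by simp)

/-- `deg det Z ≤ n`. [folklore] -/
theorem totalDegree_detZ_le :
    (rename (fun p => Sum.inr (finProdFinEquiv p)) (detPoly (Fin n) k) :
      MvPolynomial ((Fin n × Fin n) ⊕ Fin (n * n)) k).totalDegree ≤ n :=
  (totalDegree_rename_le _ _).trans
    (detPoly_isHomogeneous.totalDegree_le.trans (Fintype.card_fin n).le)

/-- `deg R_w(Z) ≤ n · n · (n + 1)`. [folklore] -/
theorem totalDegree_rankTest_le (w : Fin n → Fin n) :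
    (∏ i : Fin n, ∏ j : Fin n,
        ∑ v ∈ range ((univ.filter fun a : Fin n => a ≤ i ∧ j ≤ w a).card + 1),
          C (∏ u ∈ (range (n + 1)).erase v, ((v : k) - u))⁻¹ *
            ∏ u ∈ (range (n + 1)).erase v,
              ((∑ a ∈ univ.filter (fun a : Fin n => a ≤ i),
                  ∑ b ∈ univ.filter (fun b : Fin n => j ≤ b),
                    X (Sum.inr (finProdFinEquiv (a, b)))) + C (-(u : k))) :
      MvPolynomial ((Fin n × Fin n) ⊕ Fin (n * n)) k).totalDegree ≤ n * (n * (n + 1)) := by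
  refine (totalDegree_prod_le_of_le _ _ _ fun i _ => totalDegree_prod_le_of_le _ _ _
    fun j _ => totalDegree_thresh_le n _ _
      (totalDegree_rankCount_le i j fun p => Sum.inr (finProdFinEquiv p))).trans ?_
  simp

/-- `deg cover ≤ 2 n`. [folklore] -/
theorem totalDegree_cover_le :
    (∏ a : Fin n, ∑ b : Fin n, X (Sum.inr (finProdFinEquiv (a, b))) * X (Sum.inl (a, b)) :
      MvPolynomial ((Fin n × Fin n) ⊕ Fin (n * n)) k).totalDegree ≤ n * 2 :=
  (totalDegree_prod_le_of_le _ _ 2 fun _ _ => totalDegree_sum_le_of_le _ _ 2 fun _ _ =>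
    (totalDegree_mul _ _).trans (add_le_add (totalDegree_X_le_one _)
      (totalDegree_X_le_one _))).trans (by simp)

/-- `L(α(Z)) ≤ 4 n⁴` (`≤ n⁴` factors `1 + (-1)·(Z Z')` of cost `3`). [folklore] -/
theorem complexity_alpha_le :
    complexity (∏ pq ∈ conflictPairs n,
        (1 - X (Sum.inr (finProdFinEquiv pq.1)) * X (Sum.inr (finProdFinEquiv pq.2))) :
      MvPolynomial ((Fin n × Fin n) ⊕ Fin (n * n)) k) ≤ n ^ 4 * 3 + n ^ 4 := by
  refine (complexity_prod_le_of_le _ _ _ fun _ _ => complexity_one_sub_X_mul_X_le _ _).trans ?_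
  have h := card_conflictPairs_le n
  gcongr

/-- `L(β(Z)) ≤ n² + n` (inputs are free). [folklore] -/
theorem complexity_beta_le :
    complexity (∏ t : Fin n, ∑ i : Fin n, X (Sum.inr (finProdFinEquiv (t, i))) :
      MvPolynomial ((Fin n × Fin n) ⊕ Fin (n * n)) k) ≤ n * (n * 0 + n) + n :=
  (complexity_prod_le_of_le _ _ _ fun _ _ => complexity_sum_le_of_le _ _ _ fun _ _ =>
    le_of_eq (complexity_X_holds (k := k) _)).trans (by simp)

/-- `L(det Z) ≤ 8 (n+1)⁷` (Berkowitz, `complexity_detPoly_le`, after renaming). [folklore] -/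
theorem complexity_detZ_le :
    complexity (rename (fun p => Sum.inr (finProdFinEquiv p)) (detPoly (Fin n) k) :
      MvPolynomial ((Fin n × Fin n) ⊕ Fin (n * n)) k) ≤ 8 * (n + 1) ^ 7 :=
  (complexity_rename_le_holds' _ _).trans (complexity_detPoly_le k n)

/-- `L(R_w(Z)) ≤ n (n T + n) + n` with `T` the threshold-gadget cost at `L(r) ≤ n² + n`.
[folklore] -/
theorem complexity_rankTest_le (w : Fin n → Fin n) :
    complexity (∏ i : Fin n, ∏ j : Fin n,
        ∑ v ∈ range ((univ.filter fun a : Fin n => a ≤ i ∧ j ≤ w a).card + 1),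
          C (∏ u ∈ (range (n + 1)).erase v, ((v : k) - u))⁻¹ *
            ∏ u ∈ (range (n + 1)).erase v,
              ((∑ a ∈ univ.filter (fun a : Fin n => a ≤ i),
                  ∑ b ∈ univ.filter (fun b : Fin n => j ≤ b),
                    X (Sum.inr (finProdFinEquiv (a, b)))) + C (-(u : k))) :
      MvPolynomial ((Fin n × Fin n) ⊕ Fin (n * n)) k) ≤
      n * (n * ((n + 1) * ((n + 1) * (n * n + n + 1) + (n + 1) + 1) + (n + 1)) + n) + n := by
  refine (complexity_prod_le_of_le _ _ _ fun i _ => complexity_prod_le_of_le _ _ _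
    fun j _ => complexity_thresh_le n _ (card_filter_univ_fin_le _) _ _
      (complexity_rankCount_le i j fun p => Sum.inr (finProdFinEquiv p))).trans ?_
  simp

/-- `L(cover) ≤ n (2 n) + n`. [folklore] -/
theorem complexity_cover_le :
    complexity (∏ a : Fin n, ∑ b : Fin n,
        X (Sum.inr (finProdFinEquiv (a, b))) * X (Sum.inl (a, b)) :
      MvPolynomial ((Fin n × Fin n) ⊕ Fin (n * n)) k) ≤ n * (n * 1 + n) + n :=
  (complexity_prod_le_of_le _ _ _ fun _ _ => complexity_sum_le_of_le _ _ 1 fun _ _ =>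
    (complexity_mul_le_holds _ _).trans
      (by rw [complexity_X_holds, complexity_X_holds])).trans (by simp)

variable [CharZero k]

/-- **The `VNP` witness for `D_w`**, Boolean block `Fin (n·n)`: degree `≤ 7 (n+1)⁴`,
complexity `≤ 40 (n+1)⁷`, Boolean sum `bruhatDet k n w`. [folklore] -/
theorem exists_witness (w : Fin n → Fin n) :
    ∃ g : MvPolynomial ((Fin n × Fin n) ⊕ Fin (n * n)) k,
      g.totalDegree ≤ 7 * (n + 1) ^ 4 ∧ complexity g ≤ 40 * (n + 1) ^ 7 ∧
        boolSum g = bruhatDet k n w := by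
  refine ⟨_, ?_, ?_, boolSum_witness n k w⟩
  · refine (totalDegree_mul _ _).trans ((add_le_add ((totalDegree_mul _ _).trans
      (add_le_add (totalDegree_alpha_le n k) (totalDegree_beta_le n k)))
      ((totalDegree_mul _ _).trans (add_le_add (totalDegree_detZ_le n k)
        ((totalDegree_mul _ _).trans (add_le_add (totalDegree_rankTest_le n k w)
          (totalDegree_cover_le n k)))))).trans ?_)
    have e1 : n ^ 4 ≤ (n + 1) ^ 4 := pow_le_succ_pow n le_rfl
    have e2 : n ≤ (n + 1) ^ 4 := (pow_one n).symm.le.trans (pow_le_succ_pow n (by norm_num))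
    have e3 : n * (n * (n + 1)) ≤ (n + 1) ^ 4 := by
      have := pow_mul_pow_le n (a := 2) (b := 1) (c := 4) (by norm_num)
      rw [pow_one] at this
      nlinarith
    omega
  · have hα := complexity_alpha_le n k
    have hβ := complexity_beta_le n k
    have hd := complexity_detZ_le n k
    have hr := (complexity_rankTest_le n k w).trans (rankTest_cost_arith n)
    have hc := complexity_cover_le n k
    have e1 : n ^ 4 ≤ (n + 1) ^ 7 := pow_le_succ_pow n (by norm_num)
    have e2 : n * (n * 0 + n) + n ≤ 2 * (n + 1) ^ 7 := by nlinarith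
    have e3 : n * (n * 1 + n) + n ≤ 3 * (n + 1) ^ 7 := by nlinarith
    have e4 : 1 ≤ (n + 1) ^ 7 := Nat.one_le_pow _ _ n.succ_pos
    refine (complexity_mul_le_holds _ _).trans ?_
    refine (Nat.succ_le_succ (add_le_add (complexity_mul_le_holds _ _)
      ((complexity_mul_le_holds _ _).trans (Nat.succ_le_succ (add_le_add le_rfl
        (complexity_mul_le_holds _ _)))))).trans ?_
    omega

/-- **`(D_{w_n})_n ∈ VNP`** over any field of characteristic `0`, for every advice sequence `w`
(Valiant's criterion; Bürgisser 2000, Def. 2.5 literally: `n²` variables, degree `≤ n`, and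
`D_{w_n}` is the Boolean sum over `{0,1}^{n²}` of a `VP` witness, `exists_witness`).
[folklore] -/
theorem isVNPFamily_bruhatDet (w : (n : ℕ) → Fin n → Fin n) :
    IsVNPFamily (fun n => bruhatDet k n (w n)) := by
  choose g hdeg hcomp hsum using fun n => exists_witness n k (w n)
  refine ⟨⟨(IsPBounded.iff_exists_le_mul_succ_pow _).2 ⟨1, 2, fun n => ?_⟩,
      (IsPBounded.iff_exists_le_mul_succ_pow _).2 ⟨1, 1, fun n => ?_⟩⟩, fun n => n * n, g,
    ⟨⟨(IsPBounded.iff_exists_le_mul_succ_pow _).2 ⟨2, 2, fun n => ?_⟩,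
      (IsPBounded.iff_exists_le_mul_succ_pow _).2 ⟨7, 4, hdeg⟩⟩,
      (IsPBounded.iff_exists_le_mul_succ_pow _).2 ⟨40, 7, hcomp⟩⟩, fun n => (hsum n).symm⟩
  · simp only [Fintype.card_prod, Fintype.card_fin]
    nlinarith
  · simpa using (totalDegree_bruhatDet_le (k := k) n (w n)).trans (Nat.le_succ n)
  · simp only [Fintype.card_sum, Fintype.card_prod, Fintype.card_fin]
    nlinarith

end Bounds

end BruhatDetVNP

/-! ### The route item -/

/-- **Item `BruhatDetInVNP` of route `PartialSorting`**: for EVERY sequence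
`w = (w_n : Fin n → Fin n)`, the Bruhat-truncated determinant family
`(D_{w_n})_n = (∑_{σ : σ[i,j] ≤ w_n[i,j] ∀ i j} sgn σ ∏ₐ X_{a, σ a})_n` is a `VNP` family over `ℂ`
(Valiant 1979 / Bürgisser 2000, Prop. 2.20: the coefficient function `sgn σ · [σ ≤ w_n]` is
computed at the position matrix by a polynomial-size `VP` witness, `w_n` being advice).
[folklore] -/
theorem bruhatDetInVNP_proof :
    Summit.ValiantsHypothesis.ValiantsHypothesis.Theses.PartialSorting.BruhatDetInVNP := by
  intro w
  exact BruhatDetVNP.isVNPFamily_bruhatDet ℂ w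

end Summit.ValiantsHypothesis.ValiantsHypothesis.Theorems

end
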